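import Summits.BirchSwinnertonDyer.BirchSwinnertonDyer.Theorems.KolyvaginRankRigidityAtTwoSwapPairingEigenLines

/-!
# Crux V2♭θ `KolyvaginCorankLowerBoundAtTwoTheta` (stmt-BirchSwinnertonDyer-27220), line
# `kolyvagin_depth_split`, inside of S1 (prime swap at `2`), piece P7a — ABSTRACT PART, ONE-SIDED
# FORM (helper, PROVED, Mathlib-only; width seat `bsd-line-krr2-p2` g6)

Companion of `KolyvaginRankRigidityAtTwoSwapPairingEigenLines`: the lower bound for the local pairing
of two same-sign eigenvectors at a Kolyvagin prime at `2`, in a form that needs the eigen-line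
structure on the KUMMER side only (`Kum_v ∩ ker(σ_* − s) = ℤ g + 2`-torsion) and NOTHING on the dual
side: for the functional `φ = ⟨·, y⟩_v` of a dual class `y` with `σ_* y = s y`, `τ`-invariance of the
pairing gives `φ (σ_* a) = s φ(a)`, so `φ` kills `a − s σ_* a` and `2a = (a + s σ_* a) + (a − s σ_* a)`
reduces everything to the Kummer line.  Constant `2`:
`2^i x ≠ 0 → (∃ a ∈ Kum, 2^j φ a ≠ 0) → M + 2 ≤ i + j + 1 → 2^{i+j+1−M−2} φ x ≠ 0`.
HONEST FRAMING: helper lemma (`--supports`); S1 / V2♭θ are NOT proved; BSD is not proved by this.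

References: [Kolyvagin1991MathAnn] §2 (pairing-order estimate of the reciprocity step, `p`
arbitrary); folklore linear algebra at `2`.
-/

set_option autoImplicit false
-- the Theorems namespace of this sub repeats the summit name by design (D-0017 nested layout)
set_option linter.dupNamespace false

namespace Summit.BirchSwinnertonDyer.BirchSwinnertonDyer.Theorems.KolyvaginLowerBoundAtTwo.SwapPairing

variable {A C : Type*} [AddCommGroup A] [AddCommGroup C]

/-! ## One-sided form: no structure on the dual side -/

/-- **Abstract P7a, one-sided functional form, constant `2`.** `K ≤ A` (the Kummer part) is
stable under the involution `ι` and killed by `2^M`; the `s`-eigenvectors of `ι` in `K` are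
`ℤ g + K[2]` (`g ∈ K`); `φ : A →+ C` (the pairing with a fixed dual class) satisfies
`φ (ι a) = s • φ a` on `K`, and `2^M` kills `C`.  If `x ∈ K` is an `s`-eigenvector with
`2^i • x ≠ 0`, `2^j • φ a ≠ 0` for SOME `a ∈ K`, and `M + 2 ≤ i + j + 1`, then
`2^{i+j+1-M-2} • φ x ≠ 0`.  (No line structure on the dual side is used: `φ` kills `a - s ι a`,
and `2a = (a + s ι a) + (a - s ι a)`.) [Kolyvagin1991MathAnn §2, the pairing-order estimate, at
`p = 2`; folklore] -/
theorem pow_smul_eval_ne_zero_of_eigen {M : ℕ} (ι : A →+ A) {s : ℤ} (hs : s = 1 ∨ s = -1)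
    (K : AddSubgroup A) (hιK : ∀ a ∈ K, ι a ∈ K) (hιι : ∀ a ∈ K, ι (ι a) = a)
    (hA : ∀ a ∈ K, (2 : ℤ) ^ M • a = 0) {g : A} (hgK : g ∈ K)
    (hline : ∀ x ∈ K, ι x = s • x → ∃ (c : ℤ) (t : A), t ∈ K ∧ (2 : ℤ) • t = 0 ∧ x = c • g + t)
    (φ : A →+ C) (hφ : ∀ a ∈ K, φ (ι a) = s • φ a) (hC : ∀ c : C, (2 : ℤ) ^ M • c = 0)
    {x : A} (hxK : x ∈ K) (hx : ι x = s • x) {i j : ℕ} (hi : (2 : ℤ) ^ i • x ≠ 0)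
    (hj : ∃ a ∈ K, (2 : ℤ) ^ j • φ a ≠ 0) (hM : M + 2 ≤ i + j + 1) :
    (2 : ℤ) ^ (i + j + 1 - M - 2) • φ x ≠ 0 := by
  have hs2 : s * s = 1 := by rcases hs with rfl | rfl <;> norm_num
  obtain ⟨a, haK, hja⟩ := hj
  -- `i, j < M`, hence `1 ≤ i`, `2 ≤ j`
  have hjM : j < M := by
    by_contra hle; push Not at hle
    exact hja (by rw [show j = (j - M) + M by omega, pow_add, mul_smul, hC, smul_zero])
  have hiM : i < M := by
    by_contra hle; push Not at hle
    exact hi (by rw [show i = (i - M) + M by omega, pow_add, mul_smul, hA x hxK, smul_zero])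
  have hi1 : 1 ≤ i := by omega
  have hj2 : 2 ≤ j := by omega
  -- ### `φ g` is large: `2^{j-1} • φ g ≠ 0`
  set p := a + s • ι a with hp
  have hpK : p ∈ K := K.add_mem haK (K.zsmul_mem (hιK a haK) s)
  have hp_eig : ι p = s • p := by
    rw [hp, map_add, map_zsmul, hιι a haK, smul_add, smul_smul, hs2, one_smul, add_comm]
  have hφq : φ (a - s • ι a) = 0 := by
    rw [map_sub, map_zsmul, hφ a haK, smul_smul, hs2, one_smul, sub_self]
  have h2a : (2 : ℤ) • a = p + (a - s • ι a) := by rw [hp, two_zsmul]; abel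
  obtain ⟨c, t', -, ht', hpe⟩ := hline p hpK hp_eig
  have h4 : (4 : ℤ) • φ a = (2 * c) • φ g := by
    have e1 : (2 : ℤ) • φ a = c • φ g + φ t' := by
      rw [← map_zsmul, h2a, map_add, hφq, add_zero, hpe, map_add, map_zsmul]
    calc (4 : ℤ) • φ a = (2 : ℤ) • ((2 : ℤ) • φ a) := by rw [smul_smul]; norm_num
      _ = (2 : ℤ) • (c • φ g) + φ ((2 : ℤ) • t') := by rw [e1, smul_add, map_zsmul]
      _ = (2 * c) • φ g := by rw [ht', map_zero, add_zero, smul_smul]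
  have hg1 : (2 : ℤ) ^ (j - 1) • φ g ≠ 0 := by
    intro h0
    apply hja
    have e : (2 : ℤ) ^ j • φ a = (2 : ℤ) ^ (j - 2) • ((4 : ℤ) • φ a) := by
      rw [smul_smul, show (2 : ℤ) ^ (j - 2) * 4 = 2 ^ j by
        rw [show (4 : ℤ) = 2 ^ 2 by norm_num, ← pow_add]; congr 1; omega]
    rw [e, h4, smul_smul, show (2 : ℤ) ^ (j - 2) * (2 * c) = c * 2 ^ (j - 1) by
      rw [show j - 1 = (j - 2) + 1 by omega, pow_succ]; ring, mul_smul, h0, smul_zero]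
  -- ### decompose `x = α g + t₁` and read off the valuation of `α`
  obtain ⟨α, t₁, -, ht₁, hxe⟩ := hline x hxK hx
  have hiα : (2 : ℤ) ^ i • (α • g) ≠ 0 := by
    intro h0; apply hi
    rw [hxe, smul_add, h0, zero_add, show i = (i - 1) + 1 by omega, pow_succ, mul_smul, ht₁,
      smul_zero]
  obtain ⟨a', u, hu, hαe, ha'⟩ := exists_odd_of_pow_smul_zsmul_ne_zero (hA g hgK) hiα
  have h2x : (2 : ℤ) • φ x = (2 * α) • φ g := by
    rw [hxe, map_add, map_zsmul, smul_add, ← map_zsmul φ (2 : ℤ) t₁, ht₁, map_zero, add_zero,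
      smul_smul]
  -- ### conclusion
  intro h0
  have e1 : (2 : ℤ) • ((2 : ℤ) ^ (i + j + 1 - M - 2) • φ x) = 0 := by rw [h0, smul_zero]
  rw [smul_comm, h2x, smul_smul, hαe] at e1
  have e2 : (2 : ℤ) ^ (i + j + 1 - M - 2) * (2 * (2 ^ a' * u)) =
      u * 2 ^ (i + j + 1 - M - 2 + 1 + a') := by ring
  rw [e2, mul_smul] at e1
  have hne : (2 : ℤ) ^ (i + j + 1 - M - 2 + 1 + a') • φ g ≠ 0 := by
    intro h3
    apply hg1
    rw [show j - 1 = (j - 1 - (i + j + 1 - M - 2 + 1 + a')) + (i + j + 1 - M - 2 + 1 + a') by omega,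
      pow_add, mul_smul, h3, smul_zero]
  have hkill : (2 : ℤ) ^ M • ((2 : ℤ) ^ (i + j + 1 - M - 2 + 1 + a') • φ g) = 0 := by
    rw [smul_comm, hC, smul_zero]
  exact zsmul_ne_zero_of_odd hkill hu hne e1

end Summit.BirchSwinnertonDyer.BirchSwinnertonDyer.Theorems.KolyvaginLowerBoundAtTwo.SwapPairing
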